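import Literature.NumberTheory.PAdicHodge.AinfWeierstrassTateModule
import Literature.NumberTheory.EllipticCurves.FormalGroupNilIdealPointsGalois
import HarnessLib

/-!
# `T_p E(ℂ_F) ≅ T_pŴ(𝒪_{ℂ_F})` Γ_F-equivariantly when `E[p^∞](ℂ_F) ⊂ E₁` (the Tate-module matching at a supersingular place, ℂ_F level)

Topic `Literature/NumberTheory/PAdicHodge`; capstone of the matching lane (M) of
`Summits/…/Cruxes/StarredOptimalManinUnitFiveSeven/Lines/kato-lever-hDR-M-matching.md`: for an integral Weierstrass equation `W/ℤ`
with `Δ ≠ 0` read in `ℂ_F`, the open unit ball `maxNilIdealC F` of the A_inf bricks IS `ballNilIdeal (CompletedAlgClosure F)` of the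
dictionary files (`maxNilIdealC_eq_ballNilIdeal`, `rfl`), so `SupersingularTateModuleFormalGroup.tateModuleEquivPt` reads

* **`tateModuleCEquivTatePt : T_p E(ℂ_F) ≃ₗ[ℤ_p] TatePt F p W`** under `hss : E[pⁿ](ℂ_F) ⊂ E₁(ℂ_F)` (e.g. good supersingular reduction),
* **`tateModuleCEquivTatePt_galois`**: it intertwines the coordinatewise action of `σ ∈ Γ_F` on `E(ℂ_F)` (`galPointHom` of the isometry
  `σ` of `ℂ_F`, which fixes the integer coefficients) with the representation `tatePtRep` (`σ • ·`) on `T_pŴ(𝒪_{ℂ_F})` on which the period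
  maps `torsionLiftHom`, `omegaPeriodHom`, `htCoordHom` live.

What is NOT here (M2c): `T_p E(F̄) ≅ T_p E(ℂ_F)` (torsion is algebraic) and the comparison with `restrictedRationalTateRep`.
BSD / K★: infrastructure for the potentially supersingular cells of hDR; nothing about elliptic curves over number fields is proved here.

## References
* J. H. Silverman, *The Arithmetic of Elliptic Curves* (2009), III.§7, Prop. VII.2.2. [SilvermanAEC2009]
* J. Tate, *p-divisible groups* (1967), §4. [Tate1967]
-/

noncomputable section

open scoped Classical NNReal
open Field

namespace Literature.NumberTheory.PAdicHodge

open Literature.NumberTheory.GaloisRepresentations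
open Literature.NumberTheory.GaloisRepresentations.IsNonarchimedeanLocalField
open Literature.NumberTheory.GaloisRepresentations.LubinTate
open Literature.NumberTheory.EllipticCurves Literature.NumberTheory.EllipticCurves.FormalGroupChart

namespace AinfTop

variable {F : Type} [Field F] [ValuativeRel F] [TopologicalSpace F] [IsNonarchimedeanLocalField F]
  (W : WeierstrassCurve ℤ) {p : ℕ} [Fact p.Prime]

omit [Fact p.Prime] in
/-- The open unit ball of `𝒪_{ℂ_F}` of the A_inf bricks is the `ballNilIdeal` of the dictionary files. [cite: CasselsFrohlichANT1967, Ch. VI §3.2] -/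
theorem maxNilIdealC_eq_ballNilIdeal : maxNilIdealC F = ballNilIdeal (CompletedAlgClosure F) := rfl

omit [Fact p.Prime] in
/-- `σ ∈ Γ_F` fixes the integer coefficients read in `ℂ_F`. [cite: SilvermanAEC2009, III.§1] -/
theorem galRingHom_cK (σ : absoluteGaloisGroup F) (a : ℤ) :
    CompletedAlgClosure.galRingHom σ (cK (CompletedAlgClosure F) a) = cK (CompletedAlgClosure F) a := by
  have h : cK (CompletedAlgClosure F) a = (a : CompletedAlgClosure F) := by
    rw [cK, algebraMap_int_eq, eq_intCast]; rfl
  rw [h, map_intCast]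

omit [Fact p.Prime] in
/-- `σ ∈ Γ_F` is an isometry of `ℂ_F`. [cite: SilvermanAEC2009, III.§1] -/
theorem norm_galRingHom (σ : absoluteGaloisGroup F) (x : CompletedAlgClosure F) : ‖CompletedAlgClosure.galRingHom σ x‖ = ‖x‖ :=
  CompletedAlgClosure.norm_smul σ x

omit [Fact p.Prime] in
/-- `σ` on `ℂ_F` restricts to `galCBallAlgHom σ` on `𝒪_{ℂ_F}`. [cite: SilvermanAEC2009, III.§1] -/
theorem galRingHom_coe (σ : absoluteGaloisGroup F) (x : CBall F) :
    CompletedAlgClosure.galRingHom σ (x : CompletedAlgClosure F) = ((galCBallAlgHom σ x : CBall F) : CompletedAlgClosure F) := rfl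

/-- **The action of `σ ∈ Γ_F` on `E(ℂ_F)`** for `E = W ⊗ ℂ_F`, `W/ℤ`: `(x, y) ↦ (σx, σy)`. [cite: SilvermanAEC2009, III.§1] -/
def galPointC (σ : absoluteGaloisGroup F) :
    (curveOver (CompletedAlgClosure F) W).toAffine.Point →+ (curveOver (CompletedAlgClosure F) W).toAffine.Point :=
  galPointHom (CompletedAlgClosure.galRingHom σ) (galRingHom_cK σ)

variable [hE : (curveOver (CompletedAlgClosure F) W).IsElliptic]

variable (F p) in
/-- **`T_p E(ℂ_F) ≃ₗ[ℤ_p] T_pŴ(𝒪_{ℂ_F}) = TatePt F p W`** when every `p`-power torsion point of `E(ℂ_F)` lies in `E₁(ℂ_F)`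
(`SupersingularTateModuleFormalGroup.tateModuleEquivPt` read through `maxNilIdealC_eq_ballNilIdeal`). [cite: SilvermanAEC2009, Prop. VII.2.2] -/
def tateModuleCEquivTatePt
    (hss : ∀ (n : ℕ) (P : (curveOver (CompletedAlgClosure F) W).toAffine.Point), p ^ n • P = 0 →
      P ∈ kernel (NormedField.valuation (K := CompletedAlgClosure F)) (curveOver (CompletedAlgClosure F) W)) :
    TateModule (curveOver (CompletedAlgClosure F) W).toAffine.Point p ≃ₗ[ℤ_[p]] TatePt F p W :=
  tateModuleEquivPt W p hss

/-- Components: the `n`-th coordinate of the image of `(P_n)` is `z(P_n) ∈ 𝔪_{ℂ_F}`. [cite: SilvermanAEC2009, Prop. VII.2.2] -/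
theorem coe_seq_tateModuleCEquivTatePt
    (hss : ∀ (n : ℕ) (P : (curveOver (CompletedAlgClosure F) W).toAffine.Point), p ^ n • P = 0 →
      P ∈ kernel (NormedField.valuation (K := CompletedAlgClosure F)) (curveOver (CompletedAlgClosure F) W))
    (τ : TateModule (curveOver (CompletedAlgClosure F) W).toAffine.Point p) (n : ℕ) :
    (((seq W (tateModuleCEquivTatePt F W p hss τ) n : (maxNilIdealC F).toIdeal) : CBall F) : CompletedAlgClosure F) =
      (TateModule.proj p n τ).zCoord := rfl

/-- **Γ_F-equivariance of the matching `T_p E(ℂ_F) ≅ T_pŴ(𝒪_{ℂ_F})`**: `σ` acting coordinatewise on the torsion points of `E(ℂ_F)`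
corresponds to `σ • ·` (`tatePtRep`) on `TatePt F p W`. [cite: SilvermanAEC2009, Prop. VII.2.2] [cite: Tate1967, §4] -/
theorem tateModuleCEquivTatePt_galois
    (hss : ∀ (n : ℕ) (P : (curveOver (CompletedAlgClosure F) W).toAffine.Point), p ^ n • P = 0 →
      P ∈ kernel (NormedField.valuation (K := CompletedAlgClosure F)) (curveOver (CompletedAlgClosure F) W))
    (σ : absoluteGaloisGroup F) (τ : TateModule (curveOver (CompletedAlgClosure F) W).toAffine.Point p) :
    tateModuleCEquivTatePt F W p hss (TateModule.map p (galPointC W σ) τ) = σ • tateModuleCEquivTatePt F W p hss τ :=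
  tateModuleToPt_map_galPointHom (CompletedAlgClosure.galRingHom σ) (galRingHom_cK σ)
    (galCBallAlgHom σ) (continuous_galCBall σ) (fun _ hx => galCBall_mem hx) (fun _ => rfl) hss τ

/-- The same through the representation `tatePtRep`. [cite: Tate1967, §4] -/
theorem tateModuleCEquivTatePt_galois' 
    (hss : ∀ (n : ℕ) (P : (curveOver (CompletedAlgClosure F) W).toAffine.Point), p ^ n • P = 0 →
      P ∈ kernel (NormedField.valuation (K := CompletedAlgClosure F)) (curveOver (CompletedAlgClosure F) W))
    (σ : absoluteGaloisGroup F) (τ : TateModule (curveOver (CompletedAlgClosure F) W).toAffine.Point p) :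
    tatePtRep F p W σ (tateModuleCEquivTatePt F W p hss τ) = tateModuleCEquivTatePt F W p hss (TateModule.map p (galPointC W σ) τ) := by
  rw [tatePtRep_apply_apply, tateModuleCEquivTatePt_galois]

end AinfTop

end Literature.NumberTheory.PAdicHodge

end
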